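import Literature.MathematicalPhysics.QuantumFieldTheory.Balaban1983to89.B8Ineq159FlatCubeMemberCstar
import Literature.MathematicalPhysics.QuantumFieldTheory.Balaban1983to89.B8Ineq159FlatCubeMemberPerCube
import Literature.MathematicalPhysics.QuantumFieldTheory.Balaban1983to89.B7Prop5Flat
import Mathlib.Topology.Algebra.Module.FiniteDimension

/-!
# `Balaban1983to89.B8Ineq159FlatCubeMemberResidual` — [Balaban1985RegularSpaces] (1.59) p. 86 AT `U₀ = 1` ON THE CUBE MEMBER, PER MEMBER, WITH A
# LANDAU RESIDUAL AND MULTIPLIER CONTROL: for `𝔸`-valued bond functions (𝔸 finite-dimensional) the flat data — the defect of the Landau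
# condition (1.38) for ANY multiplier, the current `J_1`, the flat averages over print's class, the outer layer — DOMINATE the field, its
# flat derivatives AND the multiplier on the member's restriction sets (the perturbation-ready form of g0's kernel certificate)

statement-level skeleton of published theorems with citation tags; proofs where landed; nothing here is a claim about the
Yang–Mills mass gap

`[Balaban1985RegularSpaces]` ("B8", CMP **99** (1985) 75–102) (1.59) p. 86, (1.62) p. 87, (1.31) p. 82, (1.38) p. 82, (1.68) p. 88, (1.131) p. 99;
`[Balaban1985BackgroundPropagators]` ("[4]", CMP **99** (1985) 389–434) (3.19) p. 393, (3.23)–(3.25) p. 394, Thm 3.3 p. 399;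
`[Balaban1984PropagatorsII]` ("B6", CMP **96** (1984) 223–250) (2.7) p. 224, (2.11) p. 225.
PDF held: `paper:balaban1985-cmp99-regular-spaces-gauge-fixing` (journal page = PDF page + 74).

CITATION HEADER (lean-in-tree rule).  Cell `pub-ymgap` (YM Track A, HUMAN RULING D-0062 ∕ D-0149), DAG node N05 = [B8], width seat
`pub-ymgap-dag-n05-w3` (g2), CLAIM-1 file (B).  WHY.  CLAIM-1 is the per-member CURVED (1.59) at the cube member by perturbation of the PROVED flat
estimate.  A curved background `U₀` changes the Landau condition (1.38) itself (the transpose `Q′(U₀)ᵀ` and `Δ^η_{U₀}𝟙_{□₀}D^{η*}_{U₀}` move with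
`U₀`), so the flat estimate to perturb FROM must tolerate a DEFECT in (1.38) and must control the MULTIPLIER `μ` of the multiplier form (the
`Q′(U₀)ᵀμ − Q′(1)ᵀμ` term of the comparison is proportional to `μ`).  THIS FILE proves exactly that, per member with a member-dependent constant,
from g0's kernel certificate in its `𝔸`-valued form (file (A), `B8Ineq159FlatCubeMemberCstar`).

THE MATHEMATICS (kernel-checked; flat background, `𝔸` a finite-dimensional complete normed `ℂ`-algebra).
* §1 ★ `exists_bound_of_forall_eq_zero_fd` — g0's finite-dimensional domination lemma (`B8Ineq159FlatCubeMemberPerCube` §1) with VECTOR-valued data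
  and targets: on a subspace `V`, finitely many linear maps `f_a : E → W` (`W` finite-dimensional normed) with trivial joint kernel dominate every
  finite family `g_b : E → W` — left inverse of `v ↦ (f_a v)_a` on `V` + automatic continuity of linear maps out of the finite-dimensional `(A → W)`.
* §2 flat linearity over `𝔸` (the `ℂ`-valued §2 of `…PerCube` re-run for `𝔸`-valued fields; `Q_j(1)` is `B7Prop5Flat.linQIter_add` ∕
  `B7Prop4Flat.linQIter_csmul`): `iη·`, the plaquette derivative, `J_1`,
  `D^{η*}_1`, `D^η_1`, `Δ^η_1`, `Q′(1)ᵀ`, and the residual map `(φ, μ) ↦ Δ^η_1(𝟙_{□₀}D^{η*}_1φ) − Q′(1)ᵀμ`.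
* §3 ★ the CORNER EVALUATION of the flat transpose at the member ([4] (3.19)∕(3.24) with (1.68)): for `y` in the level-`j` restriction set
  `cubeLamS … m j` (`j ≤ m ≤ k`), at the block corner `x = Lʲy ∈ □₀` one has `(Q′(1)ᵀμ)(x) = L^{−jd}·μ_j(y)` — the blocks of the other levels'
  restriction sets miss `x` by the nesting `□_{j′} ⊆ □_{j+1}` (`j < j′`) ∕ `□_j ⊆ □_{j′+1}` (`j′ < j`) and the shell structure `Λ_j = □_j^{(j)} ∖ □_{j+1}^{(j)}`
  (block-saturation lemmas `mem_cube_iff_inBox_blockMap`, `mem_cube_succ_iff_inBox_blockMap`).  Hence `Q′(1)ᵀ` is INJECTIVE on multipliers read on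
  the restriction sets ([B6] (2.7): `Q′` onto ⇒ `Q′ᵀ` one-to-one), and `Q′(1)ᵀμ` only reads `μ` there (`QT_flat_congr_on`).
* §4 ★★ `exists_bound_flat_residual_perCube` — PER MEMBER (`d ≥ 2`, `L ≥ 1`, `η > 0`, `k ≥ 1`, `1 ≤ m ≤ k`) there is `B > 0` such that for EVERY
  `𝔸`-valued `φ` with the support clause of the named fact and EVERY multiplier `μ`, if `N ≥ 0` bounds (o) the Landau residual
  `|Δ^η_1(𝟙_{□₀}D^{η*}_1φ)(x) − (Q′(1)ᵀμ)(x)|`, `x ∈ □₀`, (i) `(Lʲη)³|J_1φ|` on the bonds of `□_j`, (ii) `|Lʲη·Q_j(1)(iηφ)|` on print's class, (iii) `η|φ|`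
  on the outer layer, then on the sides of `□_j`: `(Lʲη)|φ|, (Lʲη)²|D^η_1φ|, (Lʲη)³|Δ^η_1φ| ≤ BN`, AND `|μ_j(y)| ≤ BN` on every restriction set
  `cubeLamS … m j`, `j ≤ m`.  At `N`-data with zero residual this is the named fact's body per member for `𝔸`-valued fields (g0's
  `exists_B0_ineq159Flat_perCube`, «⊗ id») plus the multiplier bound.  PROOF: §1 on the subspace of pairs `(φ, μ)` (`μ` supported on the restriction
  sets), whose joint data kernel is trivial by file (A)'s `eq_zero_of_ineq159FlatData_eq_zero_cstar` and §3.

HONEST SCOPE.  Linear algebra around PROVED flat theorems; `B` depends on the member and on `𝔸` and is NOT explicit (NOT print's uniform `B₀(d, L)`);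
background FLAT; nothing of [4] Thm 3.3's random-walk expansion; this is the base estimate of the per-member curved perturbation (files (C)–(D) of
CLAIM-1), not a socket inhabitant.  Count-neutral; N05 NOT discharged; no count claim; one finite `𝕋⁴` programme at fixed `ε`, Bałaban as printed; the
YM mass gap (Clay) is NOT proved by any of this — R4 closes the conditional finite-`𝕋⁴` rung `BalabanLadder.UV` only; nothing continuum ∕ ℝ⁴ ∕ OS.
No `sorry`, no `def`, no `instance`, no `notation`.  Unit `pub-ymgap-dag-n05-w3` (g2), 2026-08-28.
-/

noncomputable section

namespace Literature.MathematicalPhysics.QuantumFieldTheory.Balaban1983to89.B8Ineq159FlatCubeMemberResidual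

/-! ## §1 Linear algebra: vector-valued data with trivial joint kernel dominate any finite vector-valued family -/

/-- ★ **DOMINATION BY VECTOR-VALUED DATA WITH TRIVIAL JOINT KERNEL** (finite-dimensional mechanism behind [B6] (2.11) «Δ is positive on N(Q′),
hence invertible» ⇒ bounds): on a submodule `V`, if finitely many linear maps `f_a : E → W` into a finite-dimensional normed space vanish
simultaneously only at `0`, then every finite family `g_b : E → W` is dominated — `‖g_b v‖ ≤ C·N` whenever all `‖f_a v‖ ≤ N` (`v ∈ V`), ONE `C ≥ 0`:
a linear left inverse of `v ↦ (f_a v)_a` on `V` (`LinearMap.exists_leftInverse_of_injective`) composed with `g_b` is a linear map out of the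
finite-dimensional normed space `A → W`, hence bounded (`LinearMap.toContinuousLinearMap`). [cite: Balaban1984PropagatorsII, (2.11) p.225] -/
theorem exists_bound_of_forall_eq_zero_fd {E : Type*} [AddCommGroup E] [Module ℂ E] (V : Submodule ℂ E)
    {W : Type*} [NormedAddCommGroup W] [NormedSpace ℂ W] [FiniteDimensional ℂ W]
    {A B : Type*} [Fintype A] [Fintype B] (f : A → E →ₗ[ℂ] W) (g : B → E →ₗ[ℂ] W)
    (hinj : ∀ v ∈ V, (∀ a, f a v = 0) → v = 0) :
    ∃ C : ℝ, 0 ≤ C ∧ ∀ v ∈ V, ∀ N : ℝ, 0 ≤ N → (∀ a, ‖f a v‖ ≤ N) → ∀ b, ‖g b v‖ ≤ C * N := by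
  classical
  let F : V →ₗ[ℂ] (A → W) := LinearMap.pi fun a => (f a).domRestrict V
  have hF : ∀ (v : V) (a : A), F v a = f a v := fun v a => rfl
  have hker : LinearMap.ker F = ⊥ := by
    rw [LinearMap.ker_eq_bot']
    intro v hv
    have h0 : ∀ a, f a v = 0 := fun a => by rw [← hF v a, hv]; rfl
    exact Subtype.ext (hinj v v.2 h0)
  obtain ⟨G, hG⟩ := LinearMap.exists_leftInverse_of_injective F hker
  have hGF : ∀ v : V, G (F v) = v := fun v => by
    have := LinearMap.congr_fun hG v
    simpa using this
  let h : B → (A → W) →L[ℂ] W := fun b => LinearMap.toContinuousLinearMap (((g b).domRestrict V) ∘ₗ G)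
  refine ⟨∑ b, ‖h b‖, by positivity, fun v hv N hN hf b => ?_⟩
  have hgv : g b v = h b (F ⟨v, hv⟩) := by
    show g b v = (g b).domRestrict V (G (F ⟨v, hv⟩))
    rw [hGF]; rfl
  have hFn : ‖F ⟨v, hv⟩‖ ≤ N := (pi_norm_le_iff_of_nonneg hN).2 fun a => by rw [hF]; exact hf a
  rw [hgv]
  calc ‖h b (F ⟨v, hv⟩)‖ ≤ ‖h b‖ * ‖F ⟨v, hv⟩‖ := (h b).le_opNorm _
    _ ≤ ‖h b‖ * N := mul_le_mul_of_nonneg_left hFn (norm_nonneg _)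
    _ ≤ (∑ b', ‖h b'‖) * N :=
        mul_le_mul_of_nonneg_right (Finset.single_le_sum (f := fun b' => ‖h b'‖) (fun _ _ => norm_nonneg _)
          (Finset.mem_univ b)) hN

variable {d : ℕ}

open B7Prop1Explicit B7Prop2Explicit B7Prop1Local
open B7Prop4GeneralLevels (linCovIter)
open B7Prop3Flat (linQ linQ_csmul)
open B7Prop4Flat (linQIter linQIter_zero linQIter_succ linQ_sub linQIter_csmul)
open B7Prop5Flat (linQIter_add)
open B9Eq316TowerFlatIsOneStep (linCovIter_one_left)
open B8Ineq132 (covDerivFwd covDeriv BondTouches)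
open B8Eq140Level (SideTouches)
open B8Eq143PlaqExpansion (pdiv pdiv_add)
open B8Eq146AExpansion (iEta plaqCovDeriv plaqCovDeriv_eq_covDerivFwd pdiv_smul)
open B8Eq155JBound (Jcur)
open B8Eq138LandauZd (IsLandau138 covLap covDivB QT)
open B8Eq131Cubes (cube sqLo sqHi inLo inHi cube_anti mem_cube_iff)
open B8Eq131CubesAdmissible (cubeFam cubeFam_false_zero cubeFam_false_of_le smul_mem_cube_iff smul_mem_cube_succ_iff)
open B8CubeMemberZd (cubeLam cubeLamS cubeLamS_of_lt cubeLamS_self cubeLamS_of_gt)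
open B8Ineq159FlatCubeMemberPrinted (cubeLamBP)
open B8Eq191FlatStencils (covDerivFwd_flat_apply covDeriv_flat_apply QT_flat_apply)
open B8Eq191FlatLettersCubeMember (inBox_finite under_iff_blockMap_eq)
open B8Ineq159FlatCubeMemberKernel (blockMap_pow_smul_self)
open B8Ineq159FlatCubeMemberCstar (eq_zero_of_ineq159FlatData_eq_zero_cstar)
open B8Ineq159FlatCubeMemberPerCube (bondTouches_cube_zero_finite cubeLamBP_pairs_finite sideTouches_pairs_finite)
open Literature.MathematicalPhysics.QuantumLattice (blockMap)
open B7BlockGeometry (blockMap_blockMap)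

export B7Prop1Explicit (Site)

variable {𝔸 : Type*} [NormedRing 𝔸] [NormOneClass 𝔸] [NormedAlgebra ℂ 𝔸] [CompleteSpace 𝔸]

/-! ## §2 Flat linearity over `𝔸` -/

omit [NormOneClass 𝔸] [CompleteSpace 𝔸] in
/-- `iηA` is additive in `A` (`𝔸`-valued). [cite: Balaban1985RegularSpaces, (1.41) p.83] -/
theorem iEta_add_cstar (η : ℝ) (φ ψ : Site d → Fin d → 𝔸) : iEta η (φ + ψ) = iEta η φ + iEta η ψ := by
  funext y κ; simp [B8Eq146AExpansion.iEta_def, smul_add]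

omit [NormOneClass 𝔸] [CompleteSpace 𝔸] in
/-- `iηA` is `ℂ`-homogeneous in `A` (`𝔸`-valued). [cite: Balaban1985RegularSpaces, (1.41) p.83] -/
theorem iEta_smul_cstar (η : ℝ) (c : ℂ) (φ : Site d → Fin d → 𝔸) : iEta η (c • φ) = c • iEta η φ := by
  funext y κ; simp [B8Eq146AExpansion.iEta_def, smul_smul, mul_comm]

omit [NormOneClass 𝔸] [CompleteSpace 𝔸] in
/-- The flat plaquette derivative (3.4) is additive (`𝔸`-valued). [cite: Balaban1985BackgroundPropagators, (3.4) p.391] -/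
theorem plaqCovDeriv_flat_add_cstar (η : ℝ) (φ ψ : Site d → Fin d → 𝔸) :
    plaqCovDeriv η (1 : Site d → Fin d → 𝔸ˣ) (φ + ψ) =
      plaqCovDeriv η (1 : Site d → Fin d → 𝔸ˣ) φ + plaqCovDeriv η (1 : Site d → Fin d → 𝔸ˣ) ψ := by
  funext μ ν x
  simp only [Pi.add_apply, plaqCovDeriv_eq_covDerivFwd, covDerivFwd_flat_apply, smul_sub, smul_add]
  abel

omit [NormOneClass 𝔸] [CompleteSpace 𝔸] in
/-- The flat plaquette derivative (3.4) is `ℂ`-homogeneous (`𝔸`-valued). [cite: Balaban1985BackgroundPropagators, (3.4) p.391] -/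
theorem plaqCovDeriv_flat_smul_cstar (η : ℝ) (c : ℂ) (φ : Site d → Fin d → 𝔸) :
    plaqCovDeriv η (1 : Site d → Fin d → 𝔸ˣ) (c • φ) = c • plaqCovDeriv η (1 : Site d → Fin d → 𝔸ˣ) φ := by
  funext μ ν x
  simp only [Pi.smul_apply, plaqCovDeriv_eq_covDerivFwd, covDerivFwd_flat_apply, smul_sub, smul_comm c (η⁻¹ : ℝ)]

omit [NormOneClass 𝔸] [CompleteSpace 𝔸] in
/-- **The flat current `J = D^{η*}_1D^η_1` (1.55) is additive** (`𝔸`-valued). [cite: Balaban1985RegularSpaces, (1.55) p.86, (1.2) p.76] -/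
theorem Jcur_flat_add_cstar (η : ℝ) (φ ψ : Site d → Fin d → 𝔸) (τ : Fin d) (y : Site d) :
    Jcur η (1 : Site d → Fin d → 𝔸ˣ) (φ + ψ) τ y = Jcur η (1 : Site d → Fin d → 𝔸ˣ) φ τ y + Jcur η (1 : Site d → Fin d → 𝔸ˣ) ψ τ y := by
  rw [B8Eq155JBound.Jcur_def, B8Eq155JBound.Jcur_def, B8Eq155JBound.Jcur_def, plaqCovDeriv_flat_add_cstar, pdiv_add]

omit [NormOneClass 𝔸] [CompleteSpace 𝔸] in
/-- **The flat current `J` is `ℂ`-homogeneous** (`𝔸`-valued). [cite: Balaban1985RegularSpaces, (1.55) p.86, (1.2) p.76] -/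
theorem Jcur_flat_smul_cstar (η : ℝ) (c : ℂ) (φ : Site d → Fin d → 𝔸) (τ : Fin d) (y : Site d) :
    Jcur η (1 : Site d → Fin d → 𝔸ˣ) (c • φ) τ y = c • Jcur η (1 : Site d → Fin d → 𝔸ˣ) φ τ y := by
  rw [B8Eq155JBound.Jcur_def, B8Eq155JBound.Jcur_def, plaqCovDeriv_flat_smul_cstar, pdiv_smul]

omit [NormOneClass 𝔸] [CompleteSpace 𝔸] in
/-- The flat divergence `D^{η*}_1` (1.38) is additive (`𝔸`-valued). [cite: Balaban1985RegularSpaces, (1.38) p.82, (1.1) p.76] -/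
theorem covDivB_flat_add_cstar (η : ℝ) (φ ψ : Site d → Fin d → 𝔸) :
    covDivB η (1 : Site d → Fin d → 𝔸ˣ) (φ + ψ) = covDivB η (1 : Site d → Fin d → 𝔸ˣ) φ + covDivB η (1 : Site d → Fin d → 𝔸ˣ) ψ := by
  funext x
  simp only [covDivB, Pi.add_apply, covDeriv_flat_apply, smul_sub, smul_add, Finset.sum_add_distrib, Finset.sum_sub_distrib]
  abel

omit [NormOneClass 𝔸] [CompleteSpace 𝔸] in
/-- The flat divergence `D^{η*}_1` is `ℂ`-homogeneous (`𝔸`-valued). [cite: Balaban1985RegularSpaces, (1.38) p.82, (1.1) p.76] -/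
theorem covDivB_flat_smul_cstar (η : ℝ) (c : ℂ) (φ : Site d → Fin d → 𝔸) :
    covDivB η (1 : Site d → Fin d → 𝔸ˣ) (c • φ) = c • covDivB η (1 : Site d → Fin d → 𝔸ˣ) φ := by
  funext x
  simp only [covDivB, Pi.smul_apply, covDeriv_flat_apply, Finset.smul_sum, smul_sub, smul_comm c (η⁻¹ : ℝ)]

omit [NormOneClass 𝔸] [CompleteSpace 𝔸] in
/-- The flat gradient is additive (as a bond field, `𝔸`-valued). [cite: Balaban1985RegularSpaces, (1.1) p.76] -/
theorem grad_flat_add_cstar (η : ℝ) (f g : Site d → 𝔸) :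
    (fun z μ => covDerivFwd η (1 : Site d → Fin d → 𝔸ˣ) μ (f + g) z) =
      (fun z μ => covDerivFwd η (1 : Site d → Fin d → 𝔸ˣ) μ f z) + (fun z μ => covDerivFwd η (1 : Site d → Fin d → 𝔸ˣ) μ g z) := by
  funext z μ
  simp only [Pi.add_apply, covDerivFwd_flat_apply, smul_sub, smul_add]
  abel

omit [NormOneClass 𝔸] [CompleteSpace 𝔸] in
/-- The flat gradient is `ℂ`-homogeneous (`𝔸`-valued). [cite: Balaban1985RegularSpaces, (1.1) p.76] -/
theorem grad_flat_smul_cstar (η : ℝ) (c : ℂ) (f : Site d → 𝔸) :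
    (fun z μ => covDerivFwd η (1 : Site d → Fin d → 𝔸ˣ) μ (c • f) z) =
      c • (fun z μ => covDerivFwd η (1 : Site d → Fin d → 𝔸ˣ) μ f z) := by
  funext z μ
  simp only [Pi.smul_apply, covDerivFwd_flat_apply, smul_sub, smul_comm c (η⁻¹ : ℝ)]

omit [NormOneClass 𝔸] [CompleteSpace 𝔸] in
/-- **The flat Laplacian (3.23) is additive** (`𝔸`-valued). [cite: Balaban1985BackgroundPropagators, (3.23) p.394] -/
theorem covLap_flat_add_cstar (η : ℝ) (f g : Site d → 𝔸) :
    covLap η (1 : Site d → Fin d → 𝔸ˣ) (f + g) = covLap η (1 : Site d → Fin d → 𝔸ˣ) f + covLap η (1 : Site d → Fin d → 𝔸ˣ) g := by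
  funext x
  show covDivB η _ (fun z μ => covDerivFwd η (1 : Site d → Fin d → 𝔸ˣ) μ (f + g) z) x = _
  rw [grad_flat_add_cstar, covDivB_flat_add_cstar]; rfl

omit [NormOneClass 𝔸] [CompleteSpace 𝔸] in
/-- **The flat Laplacian is `ℂ`-homogeneous** (`𝔸`-valued). [cite: Balaban1985BackgroundPropagators, (3.23) p.394] -/
theorem covLap_flat_smul_cstar (η : ℝ) (c : ℂ) (f : Site d → 𝔸) :
    covLap η (1 : Site d → Fin d → 𝔸ˣ) (c • f) = c • covLap η (1 : Site d → Fin d → 𝔸ˣ) f := by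
  funext x
  show covDivB η _ (fun z μ => covDerivFwd η (1 : Site d → Fin d → 𝔸ˣ) μ (c • f) z) x = _
  rw [grad_flat_smul_cstar, covDivB_flat_smul_cstar]; rfl

omit [NormOneClass 𝔸] [NormedAlgebra ℂ 𝔸] [CompleteSpace 𝔸] in
/-- Indicators are additive (bookkeeping). [folklore] -/
private theorem indicator_add'' (s : Set (Site d)) (f g : Site d → 𝔸) : s.indicator (f + g) = s.indicator f + s.indicator g := by
  funext y
  by_cases hy : y ∈ s <;> simp [hy]

omit [NormOneClass 𝔸] [CompleteSpace 𝔸] in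
/-- Indicators commute with scalars (bookkeeping). [folklore] -/
private theorem indicator_const_smul'' (s : Set (Site d)) (c : ℂ) (f : Site d → 𝔸) : s.indicator (c • f) = c • s.indicator f := by
  funext y
  by_cases hy : y ∈ s <;> simp [hy]

omit [NormOneClass 𝔸] in
/-- The flat transpose `Q′(1)ᵀ` on multipliers is additive (`𝔸`-valued). [cite: Balaban1985BackgroundPropagators, (3.24) p.394, (3.19) p.393] -/
theorem QT_flat_add_cstar (L m : ℕ) (Λs : ℕ → Set (Site d)) (μ₁ μ₂ : ℕ → Site d → 𝔸) (x : Site d) :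
    QT L m Λs (1 : Site d → Fin d → 𝔸ˣ) (μ₁ + μ₂) x =
      QT L m Λs (1 : Site d → Fin d → 𝔸ˣ) μ₁ x + QT L m Λs (1 : Site d → Fin d → 𝔸ˣ) μ₂ x := by
  rw [QT_flat_apply, QT_flat_apply, QT_flat_apply, ← Finset.sum_add_distrib]
  refine Finset.sum_congr rfl fun j _ => ?_
  rw [← smul_add, Pi.add_apply, indicator_add'', Pi.add_apply]

omit [NormOneClass 𝔸] in
/-- The flat transpose `Q′(1)ᵀ` on multipliers is `ℂ`-homogeneous (`𝔸`-valued). [cite: Balaban1985BackgroundPropagators, (3.24) p.394, (3.19) p.393] -/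
theorem QT_flat_smul_cstar (L m : ℕ) (Λs : ℕ → Set (Site d)) (c : ℂ) (μ : ℕ → Site d → 𝔸) (x : Site d) :
    QT L m Λs (1 : Site d → Fin d → 𝔸ˣ) (c • μ) x = c • QT L m Λs (1 : Site d → Fin d → 𝔸ˣ) μ x := by
  rw [QT_flat_apply, QT_flat_apply, Finset.smul_sum]
  refine Finset.sum_congr rfl fun j _ => ?_
  rw [smul_comm, Pi.smul_apply, indicator_const_smul'', Pi.smul_apply]

omit [NormOneClass 𝔸] in
/-- **The flat transpose reads the multiplier only on the restriction sets** (`μ j` on `Λs j`, `j ≤ m`). [cite: Balaban1985BackgroundPropagators, (3.24) p.394] -/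
theorem QT_flat_congr_on (L m : ℕ) (Λs : ℕ → Set (Site d)) {μ μ' : ℕ → Site d → 𝔸}
    (h : ∀ j, j ≤ m → ∀ y ∈ Λs j, μ j y = μ' j y) (x : Site d) :
    QT L m Λs (1 : Site d → Fin d → 𝔸ˣ) μ x = QT L m Λs (1 : Site d → Fin d → 𝔸ˣ) μ' x := by
  rw [QT_flat_apply, QT_flat_apply]
  refine Finset.sum_congr rfl fun j hj => ?_
  congr 1
  by_cases hy : blockMap (L ^ j) x ∈ Λs j
  · rw [Set.indicator_of_mem hy, Set.indicator_of_mem hy, h j (Nat.lt_succ_iff.mp (Finset.mem_range.mp hj)) _ hy]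
  · rw [Set.indicator_of_notMem hy, Set.indicator_of_notMem hy]

/-! ## §3 Geometry: block saturation of the cubes and the corner evaluation of the flat transpose -/

/-- **`□_j` is `Lʲ`-block saturated**: `x ∈ □_j` iff the level-`j` block index of `x` lies in `□_j^{(j)}` (p. 98: «for every j the cube □_j is a sum
of the big blocks of the lattice T_{L^{−j}}»). [cite: Balaban1985RegularSpaces, p.98, (1.131) p.99] -/
theorem mem_cube_iff_inBox_blockMap {L : ℕ} (hL : 1 ≤ L) (a : Site d) (M ρ k j : ℕ) (x : Site d) :
    x ∈ cube L a M ρ k j ↔ InBox (sqLo L a ρ k j) (sqHi L a M ρ k j) (blockMap (L ^ j) x) := by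
  rw [mem_cube_iff hL]
  constructor
  · rintro ⟨z, hz, hu⟩
    rwa [(under_iff_blockMap_eq hL j z x).1 hu]
  · intro h
    exact ⟨_, h, (under_iff_blockMap_eq hL j _ x).2 rfl⟩

/-- **`□_{j+1}` traced on the level-`j` lattice**: for `j < k`, `x ∈ □_{j+1}` iff the level-`j` block index of `x` lies in `□_{j+1}^{(j)} = [inLo j, inHi j]`
(block compatibility of the nested cubes). [cite: Balaban1985RegularSpaces, p.98, (1.131) p.99] -/
theorem mem_cube_succ_iff_inBox_blockMap {L : ℕ} (hL : 1 ≤ L) (a : Site d) (M ρ : ℕ) {k j : ℕ} (hj : j < k) (x : Site d) :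
    x ∈ cube L a M ρ k (j + 1) ↔ InBox (inLo L a ρ k j) (inHi L a M ρ k j) (blockMap (L ^ j) x) := by
  have key : ∀ z : Site d, z ∈ cube L a M ρ k (j + 1) ↔
      InBox (sqLo L a ρ k (j + 1)) (sqHi L a M ρ k (j + 1)) (blockMap L (blockMap (L ^ j) z)) := fun z => by
    rw [mem_cube_iff_inBox_blockMap hL, pow_succ, ← blockMap_blockMap]
  rw [key, ← smul_mem_cube_succ_iff hL a M ρ hj (blockMap (L ^ j) x), key, blockMap_pow_smul_self hL]

omit [NormOneClass 𝔸] [CompleteSpace 𝔸] in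
/-- The level-`j` restriction set of the member lies in the traced cube `□_j^{(j)}`. [cite: Balaban1985RegularSpaces, (1.68) p.88, (1.131) p.99] -/
theorem inBox_of_mem_cubeLamS (L : ℕ) (a : Site d) (M ρ k : ℕ) {m j : ℕ} (hjm : j ≤ m) {y : Site d}
    (hy : y ∈ cubeLamS L a M ρ k m j) : InBox (sqLo L a ρ k j) (sqHi L a M ρ k j) y := by
  rcases Nat.lt_or_ge j m with h | h
  · rw [cubeLamS_of_lt L a M ρ k h] at hy; exact hy.1
  · have hjm' : j = m := le_antisymm hjm h
    subst hjm'
    rw [cubeLamS_self] at hy; exact hy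

omit [NormOneClass 𝔸] in
/-- ★ **CORNER EVALUATION OF THE FLAT TRANSPOSE AT THE MEMBER**: for `y` in the level-`j` restriction set (`j ≤ m ≤ k`) and the block corner
`x = Lʲ·y`, `(Q′(1)ᵀμ)(x) = L^{−jd}·μ_j(y)` — the level-`j′` blocks of the other restriction sets miss `x`: for `j′ < j`, `x ∈ □_j ⊆ □_{j′+1}` puts the
level-`j′` index of `x` inside `□_{j′+1}^{(j′)}`, off the shell `Λ_{j′}`; for `j < j′ ≤ m`, a level-`j′` index in `□_{j′}^{(j′)}` would put `x ∈ □_{j′} ⊆ □_{j+1}`,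
i.e. `y ∈ □_{j+1}^{(j)}`, off the shell `Λ_j`. [cite: Balaban1985BackgroundPropagators, (3.19) p.393, (3.24) p.394; Balaban1985RegularSpaces, (1.68) p.88, (1.131) p.99] -/
theorem QT_flat_cubeMember_corner {L : ℕ} (hL : 1 ≤ L) (a : Site d) (M ρ : ℕ) {k m j : ℕ} (hjm : j ≤ m) (hmk : m ≤ k)
    {y : Site d} (hy : y ∈ cubeLamS L a M ρ k m j) (μ : ℕ → Site d → 𝔸) :
    QT L m (cubeLamS L a M ρ k m) (1 : Site d → Fin d → 𝔸ˣ) μ (((L : ℤ) ^ j) • y) = ((((L : ℝ) ^ d)⁻¹) ^ j) • μ j y := by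
  have hybox := inBox_of_mem_cubeLamS L a M ρ k hjm hy
  have hx : ((L : ℤ) ^ j) • y ∈ cube L a M ρ k j := (smul_mem_cube_iff hL a M ρ k j y).2 hybox
  rw [QT_flat_apply, Finset.sum_eq_single j]
  · rw [blockMap_pow_smul_self hL, Set.indicator_of_mem hy]
  · intro j' hj' hne
    have hj'm : j' ≤ m := Nat.lt_succ_iff.mp (Finset.mem_range.mp hj')
    rw [Set.indicator_of_notMem, smul_zero]
    intro hmem
    rcases lt_or_gt_of_ne hne with hlt | hgt
    · -- `j′ < j`: the level-`j′` index of `x` lies inside `□_{j′+1}^{(j′)}`, off the shell `Λ_{j′}`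
      have hj'k : j' < k := lt_of_lt_of_le hlt (hjm.trans hmk)
      have hx' : ((L : ℤ) ^ j) • y ∈ cube L a M ρ k (j' + 1) := cube_anti (Nat.succ_le_of_lt hlt) (hjm.trans hmk) hx
      have hin := (mem_cube_succ_iff_inBox_blockMap hL a M ρ hj'k _).1 hx'
      rw [cubeLamS_of_lt L a M ρ k (lt_of_lt_of_le hlt hjm)] at hmem
      exact hmem.2 hj'k hin
    · -- `j < j′ ≤ m`: `x ∈ □_{j′} ⊆ □_{j+1}`, so `y ∈ □_{j+1}^{(j)}`, off the shell `Λ_j`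
      have hjk : j < k := lt_of_lt_of_le hgt (hj'm.trans hmk)
      have hbox' := inBox_of_mem_cubeLamS L a M ρ k hj'm hmem
      have hxj' : ((L : ℤ) ^ j) • y ∈ cube L a M ρ k j' := (mem_cube_iff_inBox_blockMap hL a M ρ k j' _).2 hbox'
      have hxs : ((L : ℤ) ^ j) • y ∈ cube L a M ρ k (j + 1) := cube_anti (Nat.succ_le_of_lt hgt) (hj'm.trans hmk) hxj'
      have hin := (mem_cube_succ_iff_inBox_blockMap hL a M ρ hjk _).1 hxs
      rw [blockMap_pow_smul_self hL] at hin
      rw [cubeLamS_of_lt L a M ρ k (lt_of_lt_of_le hgt hj'm)] at hy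
      exact hy.2 hjk hin
  · intro hj
    exact absurd (Finset.mem_range.mpr (Nat.lt_succ_of_le hjm)) hj

/-- The block corner of a restriction-set site lies in `□₀`. [cite: Balaban1985RegularSpaces, (1.131) p.99, p.98] -/
theorem corner_mem_cube_zero {L : ℕ} (hL : 1 ≤ L) (a : Site d) (M ρ : ℕ) {k m j : ℕ} (hjm : j ≤ m) (hmk : m ≤ k)
    {y : Site d} (hy : y ∈ cubeLamS L a M ρ k m j) : ((L : ℤ) ^ j) • y ∈ cubeFam false L a M ρ k 0 := by
  rw [cubeFam_false_zero]
  exact cube_anti (Nat.zero_le j) (hjm.trans hmk) ((smul_mem_cube_iff hL a M ρ k j y).2 (inBox_of_mem_cubeLamS L a M ρ k hjm hy))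

/-- **The restriction sets of the member form a finite index set** `{(j, y) : j ≤ m, y ∈ cubeLamS … m j}`. [cite: Balaban1985RegularSpaces, (1.68) p.88, (1.131) p.99] -/
theorem cubeLamS_pairs_finite (L : ℕ) (a : Site d) (M ρ k m : ℕ) :
    {p : ℕ × Site d | p.1 ≤ m ∧ p.2 ∈ cubeLamS L a M ρ k m p.1}.Finite := by
  have hfin : ∀ j : ℕ, ({j} ×ˢ {x : Site d | InBox (sqLo L a ρ k j) (sqHi L a M ρ k j) x}).Finite :=
    fun j => (Set.finite_singleton j).prod (inBox_finite _ _)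
  refine ((Finset.range (m + 1)).finite_toSet.biUnion fun j _ => hfin j).subset ?_
  rintro ⟨j, y⟩ ⟨hj, hy⟩
  simp only [Set.mem_iUnion, Finset.coe_range, Set.mem_Iio, Set.mem_prod, Set.mem_singleton_iff, Set.mem_setOf_eq, exists_prop]
  exact ⟨j, Nat.lt_succ_of_le hj, rfl, inBox_of_mem_cubeLamS L a M ρ k hj hy⟩

/-! ## §4 The per-member flat estimate with Landau residual and multiplier control -/

/-- ★★ **(1.59) AT `U₀ = 1` ON THE CUBE MEMBER, PER MEMBER, WITH A LANDAU RESIDUAL AND MULTIPLIER CONTROL, `𝔸`-VALUED FIELDS.**  For `d ≥ 2`, `L ≥ 1`,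
`η > 0`, a cube datum `(a, M, ρ, k)` of (1.131), a truncation `1 ≤ m ≤ k`, and `𝔸` a finite-dimensional complete normed `ℂ`-algebra, THERE IS `B > 0`
(depending on the member and `𝔸`) such that for every `𝔸`-valued bond function `φ` vanishing on the bonds that side-touch no `□_j` (`j ≤ m`), every
multiplier `μ`, and every `N ≥ 0` bounding
(o) the RESIDUAL of the flat Landau condition (1.38) in multiplier form, `‖Δ^η_1(𝟙_{□₀}D^{η*}_1φ)(x) − (Q′(1)ᵀμ)(x)‖ ≤ N` for `x ∈ □₀`;
(i) `(Lʲη)³|J_1(φ)|` on the bonds of `□_j`, `j ≤ m`; (ii) the flat averages `|Lʲη·Q_j(1)(iηφ)(c)|` on print's class `cubeLamBP … m j`; (iii) `η|φ|` on the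
outer layer (bonds with no end in `□₀`) — one has on every bond side-touching `□_j`: `(Lʲη)|φ| ≤ BN`, `(Lʲη)²|D^η_{1,ν}φ_τ| ≤ BN`, `(Lʲη)³|Δ^η_1φ_τ| ≤ BN`,
AND `‖μ_j(y)‖ ≤ BN` for every `j ≤ m`, `y ∈ cubeLamS … m j`.  PROOF: §1 on the subspace of pairs `(φ, μ)` with `μ` supported on the restriction sets;
the joint kernel of the data is trivial there by file (A)'s `eq_zero_of_ineq159FlatData_eq_zero_cstar` (zero residual = (1.38) with multiplier `μ`)
followed by the corner evaluation §3 (`Q′(1)ᵀμ = 0` on `□₀` ⇒ `μ = 0` on the restriction sets); a general `μ` is replaced by its restriction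
(`QT_flat_congr_on`).  HONEST SCOPE: `B` NOT explicit, NOT print's uniform constant; background flat.
[cite: Balaban1985RegularSpaces, (1.59) p.86, (1.62) p.87, (1.31) p.82, (1.38) p.82, (1.131) p.99; Balaban1984PropagatorsII, (2.11) p.225, (2.7) p.224; Balaban1985BackgroundPropagators, Thm 3.3 p.399, (3.24)–(3.25) p.394] -/
theorem exists_bound_flat_residual_perCube [FiniteDimensional ℂ 𝔸] (hd2 : 2 ≤ d) {L : ℕ} (hL : 1 ≤ L) {η : ℝ} (hη : 0 < η)
    (a : Site d) (M ρ : ℕ) {k m : ℕ} (hm1 : 1 ≤ m) (hmk : m ≤ k) :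
    ∃ B : ℝ, 0 < B ∧ ∀ (φ : Site d → Fin d → 𝔸) (μ : ℕ → Site d → 𝔸),
      (∀ (y : Site d) (τ : Fin d), (∀ j, j ≤ m → ¬ SideTouches (cubeFam false L a M ρ k j) y τ) → φ y τ = 0) →
      ∀ N : ℝ, 0 ≤ N →
        (∀ x ∈ cubeFam false L a M ρ k 0,
            ‖covLap η (1 : Site d → Fin d → 𝔸ˣ) ((cubeFam false L a M ρ k 0).indicator (covDivB η (1 : Site d → Fin d → 𝔸ˣ) φ)) x
              - QT L m (cubeLamS L a M ρ k m) (1 : Site d → Fin d → 𝔸ˣ) μ x‖ ≤ N) →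
        (∀ j, j ≤ m → ∀ (y : Site d) (τ : Fin d), BondTouches (cubeFam false L a M ρ k j) y τ →
            ((L : ℝ) ^ j * η) ^ 3 * ‖Jcur η (1 : Site d → Fin d → 𝔸ˣ) φ τ y‖ ≤ N) →
        (∀ j, j ≤ m → ∀ c ∈ cubeLamBP L a M ρ k m j,
            ‖linCovIter L (1 : Site d → Fin d → 𝔸ˣ) (iEta η φ) j c.1 c.2‖ ≤ N) →
        (∀ (y : Site d) (τ : Fin d), ¬ BondTouches (cubeFam false L a M ρ k 0) y τ → η * ‖φ y τ‖ ≤ N) →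
        (∀ j, j ≤ m → ∀ (y : Site d) (τ : Fin d), SideTouches (cubeFam false L a M ρ k j) y τ →
          ((L : ℝ) ^ j * η) * ‖φ y τ‖ ≤ B * N ∧
          (∀ ν : Fin d, ((L : ℝ) ^ j * η) ^ 2 *
            ‖covDerivFwd η (1 : Site d → Fin d → 𝔸ˣ) ν (fun z => φ z τ) y‖ ≤ B * N) ∧
          ((L : ℝ) ^ j * η) ^ 3 * ‖covLap η (1 : Site d → Fin d → 𝔸ˣ) (fun z => φ z τ) y‖ ≤ B * N) ∧
        (∀ j, j ≤ m → ∀ y ∈ cubeLamS L a M ρ k m j, ‖μ j y‖ ≤ B * N) := by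
  classical
  have hΩ0 : cubeFam false L a M ρ k 0 = cube L a M ρ k 0 := cubeFam_false_zero L a M ρ k
  -- the finite index sets of the member
  set T0 := (inBox_finite (sqLo L a ρ k 0) (sqHi L a M ρ k 0)).toFinset with hT0
  set TB := (bondTouches_cube_zero_finite L a M ρ k).toFinset with hTB
  set TC := (cubeLamBP_pairs_finite L a M ρ k m).toFinset with hTC
  set TS := (sideTouches_pairs_finite L a M ρ hmk).toFinset with hTS
  set TM := (cubeLamS_pairs_finite L a M ρ k m).toFinset with hTM
  have hS3fin : {b : Site d × Fin d | (∃ j, j ≤ m ∧ SideTouches (cubeFam false L a M ρ k j) b.1 b.2) ∧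
      ¬ BondTouches (cubeFam false L a M ρ k 0) b.1 b.2}.Finite := by
    refine ((sideTouches_pairs_finite L a M ρ hmk).image Prod.snd).subset ?_
    rintro ⟨y, τ⟩ ⟨⟨j, hj, hs⟩, -⟩
    exact ⟨(j, (y, τ)), ⟨hj, hs⟩, rfl⟩
  set T3 := hS3fin.toFinset with hT3
  have memT0 : ∀ {x}, x ∈ cubeFam false L a M ρ k 0 → x ∈ T0 := fun h => by
    rw [hT0, Set.Finite.mem_toFinset]; rw [hΩ0] at h; exact h
  have memTB : ∀ {y τ}, BondTouches (cubeFam false L a M ρ k 0) y τ → (y, τ) ∈ TB := fun h => by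
    rw [hTB, Set.Finite.mem_toFinset]; rw [hΩ0] at h; exact h
  have memTC : ∀ {j c}, j ≤ m → c ∈ cubeLamBP L a M ρ k m j → (j, c) ∈ TC := fun hj hc => by
    rw [hTC, Set.Finite.mem_toFinset]; exact ⟨hj, hc⟩
  have memTS : ∀ {j y τ}, j ≤ m → SideTouches (cubeFam false L a M ρ k j) y τ → (j, (y, τ)) ∈ TS := fun hj hs => by
    rw [hTS, Set.Finite.mem_toFinset]; exact ⟨hj, hs⟩
  have memTM : ∀ {j y}, j ≤ m → y ∈ cubeLamS L a M ρ k m j → (j, y) ∈ TM := fun hj hy => by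
    rw [hTM, Set.Finite.mem_toFinset]; exact ⟨hj, hy⟩
  have memT3 : ∀ {y τ}, (∃ j, j ≤ m ∧ SideTouches (cubeFam false L a M ρ k j) y τ) →
      ¬ BondTouches (cubeFam false L a M ρ k 0) y τ → (y, τ) ∈ T3 := fun h1 h2 => by
    rw [hT3, Set.Finite.mem_toFinset]; exact ⟨h1, h2⟩
  -- boundedness of a field with the support clause
  have hbdd : ∀ φ : Site d → Fin d → 𝔸,
      (∀ (y : Site d) (τ : Fin d), (∀ j, j ≤ m → ¬ SideTouches (cubeFam false L a M ρ k j) y τ) → φ y τ = 0) →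
      ∃ b : ℝ, 0 ≤ b ∧ ∀ y τ, ‖iEta η φ y τ‖ ≤ b := by
    intro φ hs
    refine ⟨∑ q ∈ TS, ‖iEta η φ q.2.1 q.2.2‖, Finset.sum_nonneg fun _ _ => norm_nonneg _, fun y τ => ?_⟩
    by_cases h : ∃ j, j ≤ m ∧ SideTouches (cubeFam false L a M ρ k j) y τ
    · obtain ⟨j, hj, hst⟩ := h
      exact Finset.single_le_sum (f := fun q : ℕ × (Site d × Fin d) => ‖iEta η φ q.2.1 q.2.2‖)
        (fun _ _ => norm_nonneg _) (memTS hj hst)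
    · push Not at h
      have h0 : φ y τ = 0 := hs y τ fun j hj hst => h j hj hst
      simp only [B8Eq146AExpansion.iEta_def, h0, smul_zero, norm_zero]
      exact Finset.sum_nonneg fun _ _ => norm_nonneg _
  -- the ambient module of pairs `(φ, μ)` and the subspace
  let E := (Site d → Fin d → 𝔸) × (ℕ → Site d → 𝔸)
  let V : Submodule ℂ E :=
    { carrier := {p | (∀ (y : Site d) (τ : Fin d), (∀ j, j ≤ m → ¬ SideTouches (cubeFam false L a M ρ k j) y τ) → p.1 y τ = 0) ∧
        ∀ (j : ℕ) (y : Site d), ¬ (j ≤ m ∧ y ∈ cubeLamS L a M ρ k m j) → p.2 j y = 0}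
      add_mem' := by
        rintro p q ⟨h1, h2⟩ ⟨h3, h4⟩
        exact ⟨fun y τ h => by
            show p.1 y τ + q.1 y τ = 0
            rw [h1 y τ h, h3 y τ h, add_zero],
          fun j y h => by
            show p.2 j y + q.2 j y = 0
            rw [h2 j y h, h4 j y h, add_zero]⟩
      zero_mem' := ⟨fun _ _ _ => rfl, fun _ _ _ => rfl⟩
      smul_mem' := by
        rintro c p ⟨h1, h2⟩
        exact ⟨fun y τ h => by
            show c • p.1 y τ = 0
            rw [h1 y τ h, smul_zero],
          fun j y h => by
            show c • p.2 j y = 0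
            rw [h2 j y h, smul_zero]⟩ }
  have hVmem : ∀ {p : E}, p ∈ V ↔
      ((∀ (y : Site d) (τ : Fin d), (∀ j, j ≤ m → ¬ SideTouches (cubeFam false L a M ρ k j) y τ) → p.1 y τ = 0) ∧
        ∀ (j : ℕ) (y : Site d), ¬ (j ≤ m ∧ y ∈ cubeLamS L a M ρ k m j) → p.2 j y = 0) := Iff.rfl
  -- the linear maps (all `𝔸`-valued)
  let ev : Site d → Fin d → E →ₗ[ℂ] 𝔸 := fun y τ =>
    { toFun := fun p => p.1 y τ, map_add' := fun _ _ => rfl, map_smul' := fun _ _ => rfl }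
  let evM : ℕ → Site d → E →ₗ[ℂ] 𝔸 := fun j y =>
    { toFun := fun p => p.2 j y, map_add' := fun _ _ => rfl, map_smul' := fun _ _ => rfl }
  let Jl : Site d → Fin d → E →ₗ[ℂ] 𝔸 := fun y τ =>
    { toFun := fun p => Jcur η (1 : Site d → Fin d → 𝔸ˣ) p.1 τ y
      map_add' := fun p q => Jcur_flat_add_cstar η p.1 q.1 τ y
      map_smul' := fun c p => Jcur_flat_smul_cstar η c p.1 τ y }
  let Ql : ℕ → Site d → Fin d → E →ₗ[ℂ] 𝔸 := fun j z κ =>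
    { toFun := fun p => linQIter L (iEta η p.1) j z κ
      map_add' := fun p q => by
        show linQIter L (iEta η (p.1 + q.1)) j z κ = _
        rw [iEta_add_cstar, linQIter_add]
      map_smul' := fun c p => by
        show linQIter L (iEta η (c • p.1)) j z κ = _
        rw [iEta_smul_cstar, linQIter_csmul]; rfl }
  let Dl : Fin d → Site d → Fin d → E →ₗ[ℂ] 𝔸 := fun ν y τ =>
    { toFun := fun p => covDerivFwd η (1 : Site d → Fin d → 𝔸ˣ) ν (fun z => p.1 z τ) y
      map_add' := fun p q => by
        show covDerivFwd η (1 : Site d → Fin d → 𝔸ˣ) ν (fun z => p.1 z τ + q.1 z τ) y = _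
        simp only [covDerivFwd_flat_apply, smul_add, smul_sub]
        abel
      map_smul' := fun c p => by
        show covDerivFwd η (1 : Site d → Fin d → 𝔸ˣ) ν (fun z => c • p.1 z τ) y = _
        simp only [covDerivFwd_flat_apply, smul_sub, RingHom.id_apply, smul_comm c (η⁻¹ : ℝ)] }
  let Ll : Site d → Fin d → E →ₗ[ℂ] 𝔸 := fun y τ =>
    { toFun := fun p => covLap η (1 : Site d → Fin d → 𝔸ˣ) (fun z => p.1 z τ) y
      map_add' := fun p q => by
        exact congrFun (covLap_flat_add_cstar η (fun z => p.1 z τ) (fun z => q.1 z τ)) y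
      map_smul' := fun c p => by
        exact congrFun (covLap_flat_smul_cstar η c (fun z => p.1 z τ)) y }
  let Rl : Site d → E →ₗ[ℂ] 𝔸 := fun x =>
    { toFun := fun p => covLap η (1 : Site d → Fin d → 𝔸ˣ) ((cubeFam false L a M ρ k 0).indicator
          (covDivB η (1 : Site d → Fin d → 𝔸ˣ) p.1)) x - QT L m (cubeLamS L a M ρ k m) (1 : Site d → Fin d → 𝔸ˣ) p.2 x
      map_add' := fun p q => by
        show covLap η (1 : Site d → Fin d → 𝔸ˣ) ((cubeFam false L a M ρ k 0).indicator
            (covDivB η (1 : Site d → Fin d → 𝔸ˣ) (p.1 + q.1))) x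
            - QT L m (cubeLamS L a M ρ k m) (1 : Site d → Fin d → 𝔸ˣ) (p.2 + q.2) x = _
        rw [covDivB_flat_add_cstar, indicator_add'', covLap_flat_add_cstar, Pi.add_apply, QT_flat_add_cstar]
        abel
      map_smul' := fun c p => by
        show covLap η (1 : Site d → Fin d → 𝔸ˣ) ((cubeFam false L a M ρ k 0).indicator
            (covDivB η (1 : Site d → Fin d → 𝔸ˣ) (c • p.1))) x
            - QT L m (cubeLamS L a M ρ k m) (1 : Site d → Fin d → 𝔸ˣ) (c • p.2) x = _
        rw [covDivB_flat_smul_cstar, indicator_const_smul'', covLap_flat_smul_cstar, Pi.smul_apply, QT_flat_smul_cstar,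
          RingHom.id_apply, smul_sub] }
  -- data and target families
  let f : (↥T0 ⊕ (↥TB ⊕ (↥TC ⊕ ↥T3))) → E →ₗ[ℂ] 𝔸 :=
    Sum.elim (fun x => Rl x.1)
      (Sum.elim (fun b => ((η : ℂ) ^ 3) • Jl b.1.1 b.1.2)
        (Sum.elim (fun p => Ql p.1.1 p.1.2.1 p.1.2.2) (fun b => (η : ℂ) • ev b.1.1 b.1.2)))
  let g : (↥TS ⊕ ((↥TS × Fin d) ⊕ (↥TS ⊕ ↥TM))) → E →ₗ[ℂ] 𝔸 :=
    Sum.elim (fun q => (((L : ℝ) ^ q.1.1 * η : ℝ) : ℂ) • ev q.1.2.1 q.1.2.2)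
      (Sum.elim (fun qν => ((((L : ℝ) ^ qν.1.1.1 * η) ^ 2 : ℝ) : ℂ) • Dl qν.2 qν.1.1.2.1 qν.1.1.2.2)
        (Sum.elim (fun q => ((((L : ℝ) ^ q.1.1 * η) ^ 3 : ℝ) : ℂ) • Ll q.1.2.1 q.1.2.2) (fun p => evM p.1.1 p.1.2)))
  have hηC : (η : ℂ) ≠ 0 := Complex.ofReal_ne_zero.2 hη.ne'
  -- joint kernel of the data is trivial on `V`: the kernel theorem, then the corner evaluation
  have hinj : ∀ p ∈ V, (∀ x, f x p = 0) → p = 0 := by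
    intro p hpV hf0
    obtain ⟨hs, hμ⟩ := (hVmem).1 hpV
    obtain ⟨b, hb0, hb⟩ := hbdd p.1 hs
    -- support on the touching bonds
    have hsupp : ∀ (y : Site d) (τ : Fin d), ¬ BondTouches (cubeFam false L a M ρ k 0) y τ → p.1 y τ = 0 := by
      intro y τ hbt
      by_cases h : ∃ j, j ≤ m ∧ SideTouches (cubeFam false L a M ρ k j) y τ
      · have := hf0 (Sum.inr (Sum.inr (Sum.inr ⟨(y, τ), memT3 h hbt⟩)))
        simp only [f, Sum.elim_inr, LinearMap.smul_apply, smul_eq_zero] at this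
        rcases this with h0 | h0
        · exact absurd h0 hηC
        · exact h0
      · push Not at h
        exact hs y τ fun j hj hst => h j hj hst
    -- the Landau condition with multiplier `p.2` (zero residual)
    have hres : ∀ x ∈ cubeFam false L a M ρ k 0,
        covLap η (1 : Site d → Fin d → 𝔸ˣ) ((cubeFam false L a M ρ k 0).indicator (covDivB η (1 : Site d → Fin d → 𝔸ˣ) p.1)) x
          = QT L m (cubeLamS L a M ρ k m) (1 : Site d → Fin d → 𝔸ˣ) p.2 x := by
      intro x hx
      have := hf0 (Sum.inl ⟨x, memT0 hx⟩)
      exact sub_eq_zero.1 this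
    have hLan : IsLandau138 L m η (cubeFam false L a M ρ k 0) (cubeLamS L a M ρ k m) (1 : Site d → Fin d → 𝔸ˣ) p.1 :=
      ⟨p.2, hres⟩
    have hφ0 : p.1 = 0 := by
      refine eq_zero_of_ineq159FlatData_eq_zero_cstar hd2 hL hη a M ρ hm1 hmk hLan hsupp ?_ ?_
      · intro y τ hbt
        have := hf0 (Sum.inr (Sum.inl ⟨(y, τ), memTB hbt⟩))
        simp only [f, Sum.elim_inr, Sum.elim_inl, LinearMap.smul_apply, smul_eq_zero] at this
        rcases this with h0 | h0
        · exact absurd h0 (pow_ne_zero 3 hηC)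
        · exact h0
      · intro j hj c hc
        have := hf0 (Sum.inr (Sum.inr (Sum.inl ⟨(j, c), memTC hj hc⟩)))
        simp only [f, Sum.elim_inr, Sum.elim_inl] at this
        rw [linCovIter_one_left L hL (iEta η p.1) hb0 hb j]
        exact this
    -- the multiplier vanishes on the restriction sets (corner evaluation) and off them (membership in `V`)
    have hQT0 : ∀ x ∈ cubeFam false L a M ρ k 0, QT L m (cubeLamS L a M ρ k m) (1 : Site d → Fin d → 𝔸ˣ) p.2 x = 0 := by
      intro x hx
      rw [← hres x hx, hφ0]
      have h0 : covDivB η (1 : Site d → Fin d → 𝔸ˣ) (0 : Site d → Fin d → 𝔸) = 0 := by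
        funext z; simp [covDivB, covDeriv_flat_apply]
      rw [h0, Set.indicator_zero']
      simp [covLap, covDivB, covDeriv_flat_apply, covDerivFwd_flat_apply]
    have hμ0 : p.2 = 0 := by
      funext j y
      by_cases h : j ≤ m ∧ y ∈ cubeLamS L a M ρ k m j
      · have hc := QT_flat_cubeMember_corner hL a M ρ h.1 hmk h.2 p.2
        rw [hQT0 _ (corner_mem_cube_zero hL a M ρ h.1 hmk h.2)] at hc
        have hLd : ((((L : ℝ) ^ d)⁻¹) ^ j) ≠ 0 := by positivity
        exact ((smul_eq_zero.1 hc.symm).resolve_left hLd)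
      · exact hμ j y h
    exact Prod.ext hφ0 hμ0
  obtain ⟨C, hC0, hC⟩ := exists_bound_of_forall_eq_zero_fd V f g hinj
  refine ⟨max C 1, by positivity, fun φ μ hs N hN h0 h1 h2 h3 => ?_⟩
  -- restrict the multiplier to the restriction sets
  let μ' : ℕ → Site d → 𝔸 := fun j y => if j ≤ m ∧ y ∈ cubeLamS L a M ρ k m j then μ j y else 0
  have hμ'eq : ∀ j, j ≤ m → ∀ y ∈ cubeLamS L a M ρ k m j, μ j y = μ' j y := fun j hj y hy => by
    simp only [μ', hj, hy, and_self, if_true]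
  have hpV : ((φ, μ') : E) ∈ V := (hVmem).2 ⟨hs, fun j y h => by simp only [μ', h, if_false]⟩
  obtain ⟨b, hb0, hb⟩ := hbdd φ hs
  -- the data bounds
  have hfa : ∀ x, ‖f x (φ, μ')‖ ≤ N := by
    rintro (xx | bb | pp | bb)
    · obtain ⟨x, hmem⟩ := xx
      have hx : x ∈ cubeFam false L a M ρ k 0 := by
        rw [hT0, Set.Finite.mem_toFinset] at hmem; rw [hΩ0]; exact hmem
      have := h0 x hx
      rw [QT_flat_congr_on L m _ hμ'eq x] at this
      exact this
    · obtain ⟨⟨y', τ'⟩, hmem⟩ := bb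
      have hbt : BondTouches (cubeFam false L a M ρ k 0) y' τ' := by
        rw [hTB, Set.Finite.mem_toFinset] at hmem; rw [hΩ0]; exact hmem
      have := h1 0 (Nat.zero_le m) y' τ' hbt
      rw [pow_zero, one_mul] at this
      simp only [f, Sum.elim_inr, Sum.elim_inl, LinearMap.smul_apply, norm_smul, norm_pow, Complex.norm_real,
        Real.norm_of_nonneg hη.le]
      exact this
    · obtain ⟨⟨j', c⟩, hmem⟩ := pp
      have hmem' : j' ≤ m ∧ c ∈ cubeLamBP L a M ρ k m j' := by rw [hTC, Set.Finite.mem_toFinset] at hmem; exact hmem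
      have := h2 j' hmem'.1 c hmem'.2
      rw [linCovIter_one_left L hL (iEta η φ) hb0 hb j'] at this
      exact this
    · obtain ⟨⟨y', τ'⟩, hmem⟩ := bb
      have hmem' := hmem
      rw [hT3, Set.Finite.mem_toFinset] at hmem'
      have := h3 y' τ' hmem'.2
      simp only [f, Sum.elim_inr, LinearMap.smul_apply, norm_smul, Complex.norm_real, Real.norm_of_nonneg hη.le]
      exact this
  have key := hC (φ, μ') hpV N hN hfa
  have hCle : C * N ≤ max C 1 * N := mul_le_mul_of_nonneg_right (le_max_left _ _) hN
  refine ⟨fun j hj y τ hst => ?_, fun j hj y hy => ?_⟩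
  · have hw : 0 ≤ (L : ℝ) ^ j * η := by positivity
    have hq : (j, (y, τ)) ∈ TS := memTS hj hst
    refine ⟨?_, fun ν => ?_, ?_⟩
    · have := key (Sum.inl ⟨(j, (y, τ)), hq⟩)
      simp only [g, ev, Sum.elim_inl, LinearMap.smul_apply, LinearMap.coe_mk, AddHom.coe_mk, norm_smul, Complex.norm_real,
        Real.norm_of_nonneg hw] at this
      exact this.trans hCle
    · have := key (Sum.inr (Sum.inl (⟨(j, (y, τ)), hq⟩, ν)))
      simp only [g, Dl, Sum.elim_inr, Sum.elim_inl, LinearMap.smul_apply, LinearMap.coe_mk, AddHom.coe_mk, norm_smul,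
        Complex.norm_real, Real.norm_of_nonneg (pow_nonneg hw 2)] at this
      exact this.trans hCle
    · have := key (Sum.inr (Sum.inr (Sum.inl ⟨(j, (y, τ)), hq⟩)))
      simp only [g, Ll, Sum.elim_inr, Sum.elim_inl, LinearMap.smul_apply, LinearMap.coe_mk, AddHom.coe_mk, norm_smul,
        Complex.norm_real, Real.norm_of_nonneg (pow_nonneg hw 3)] at this
      exact this.trans hCle
  · have := key (Sum.inr (Sum.inr (Sum.inr ⟨(j, y), memTM hj hy⟩)))
    simp only [g, evM, Sum.elim_inr, LinearMap.coe_mk, AddHom.coe_mk] at this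
    rw [hμ'eq j hj y hy]
    exact this.trans hCle

end Literature.MathematicalPhysics.QuantumFieldTheory.Balaban1983to89.B8Ineq159FlatCubeMemberResidual

end
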